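import Summits.HodgeConjecture.HodgeConjecture.Theorems.F0P2iGRDMatrixLocality   -- ★ p819096 (F0P2-p02 (g4), GRD-LOC 2∕2): `stubGRD_of_pointwise` (locality of the dictionary in `μ`)
import Summits.HodgeConjecture.HodgeConjecture.Theorems.F0P2iGRDSplit            -- ★ p817998 (F0P2-p01 (g5), GRD-(S)): `grdMatrix_split_of_dictionary` (split half ⟸ (Dν), (Dψ))
import Summits.HodgeConjecture.HodgeConjecture.Theorems.F0P2iVocabularyBridge    -- ★ p818933 (this seat): `thetaTypeAt_iff_CM` (Lines `ThetaTypeAt` body ↔ Literature `ThetaTypeAtCM`)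
import Literature.NumberTheory.GelbartRogawski1991.WeilLiftNonsplitPrincipalSeriesConstituent   -- ★ p818501 (F0-typ1 (g5)): the PRINT letter U′-N `GR91Lemma512NonsplitAsPrinted` (+ `.nonsplit`)
import Summits.HodgeConjecture.HodgeConjecture.Theorems.F0P2iGRDWitness          -- ★ p819322 (F0P2-p01 (g5), DICT-CHOICE): `grdMu`, `grdChi` + the pins and the split identities from the pins
import Literature.NumberTheory.GelbartRogawski1991.CMThetaTypeVocabulary              -- ★ p818127 (this seat): `GRDMatrixCM` ∕ `ThetaTypeAtCM` (the statement of record is over the vocabulary BY NAME, F0P2-plan 09:59:07Z)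
import HarnessLib

/-!
# Crux `H413` · programme P2 · PKΠ RUNG 4 — the GRD ASSEMBLY: `StubGRD` ⟸ U′-N + ★ (S) + ★ GRD-LOC + a dictionary WITNESS

Cell hodgecm-mathlib (D-0151), FLOOR 0, crux item H413 = stmt-HodgeConjecture-24833; sub-line of record `Cruxes/H413/Lines/F0_P2PKPiRung4.lean` v1.1
(F0P2-plan (g6), sha16 2e54cdb2dda5824f), registered stub `stub_GRD : StubGRD` (:419).  PROVER FILE (A-p17 (g15); F0P2-plan GO 09:20:44Z «ONE closer for
the whole letter»), THEOREMS ONLY, kernel lane `--supports stmt-HodgeConjecture-24833 --as helper`; never imports a `Cruxes/…/Lines` module (O50-1).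
HONEST LABEL: HC_CM is proved only modulo the printed citations until rung 0 closes; this file spends EXACTLY ONE printed citation — the U′-N letter
`GR91Lemma512NonsplitAsPrinted` ([GelbartRogawski1991, (5.1.1), Lem. 5.1.2]: at a non-split place the Weil-representation type is a constituent of
`i_G(χ_ξ)`), taken as the hypothesis `hGR` (director s515 (2): +1 fan-B row, booked at ★ p818501) — everything else is ★ in-house.

WHAT IT PROVES.  `StubGRD` (v1.1 :318–331) says: for every theta frame of `U(H)`, every one-dimensional `ξ = (η, ψ)` and Rogawski's `μω`, there is a
dictionary pair `(μ₀, χ_f)` (`μ₀` conjugate-symplectic, `χ_f` continuous unitary) such that EVERY conjugate-symplectic `μ` with `μ`'s finite semi-local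
components equal to `μ₀`'s satisfies the finite dictionary `GRDMatrix … ξ μω hμu μ hμ χf` ((S) split places + (N) non-split places).  Here:

* `grdMatrix_grdMu_grdChi_of_GR91N (hGR) (L …) (H hH hHd) (e₁ dV hdV hdV0 g hg) (ξ μω hμu) (hquad) : GRDMatrixCM … ξ μω hμu (grdMu …) (isConjugateSymplectic_grdMu …) (grdChi …)` —
  the finite dictionary PINNED at F0P2-p01 (g5)'s ★ DICT-CHOICE `μ := grdMu L ξ μω hμu` (`toHeckeCharacter (grdMu …) = η̃⁻¹ ψ̃⁻¹ μω`, conjugate-symplectic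
  by `hquad`), `χf := grdChi L ξ μω hquad` (`grdChi ∘ (z ↦ z/z̄) = (ψ̃⁻¹ (η̃⁻¹ψ̃⁻¹μω)²)_f`, continuous, unitary) [★ `Theorems/F0P2iGRDWitness.lean`], stated over the ★ VOCABULARY BY NAME (F0P2-plan (g6)
  09:56:28Z (ii) as amended 09:59:07Z; the v1.4 head does `have hm : GRDMatrix … := ‹this›` by δ-unfolding): conjunct (S) = ★ `F0P2iGRDSplit.grdMatrix_split_of_dictionary` fed the split identities (Dν)
  `splitNu0_eq_localComponent_of_pin`, (Dψ) `locPsi_eq_wReading_mul_zpow_of_pins` (both from the witness's pins); conjunct (N) = the letter's projection ★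
  `GR91Lemma512NonsplitAsPrinted.nonsplit` fed the pins (Dμ) `semilocalComponent_toHeckeCharacter_grdMu`, (Dχ) `grdChi_finAdelicCheck`, read back into
  the sub-line's `ThetaTypeAt` currency through ★ `thetaTypeAt_iff_CM` (`.mpr`) — the bridge pays the Lines↔Literature defeq once;
* `stubGRD_of_GR91N (hGR) : ‹StubGRD body›` — the registered letter's ∃-form: by ★ `F0P2iGRDMatrixLocality.stubGRD_of_pointwise` (the matrix is LOCAL in
  `μ` [Kudla1994 Thm. 3.1], GRD-LOC) it suffices to give the witness with its matrix = the previous theorem.  THE v1.2 FOLD (registrar): `theorem stub_GRD : StubGRD := stubGRD_of_GR91N stub_GR91N` —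
  the conclusion below is the `StubGRD` body with `GRDMatrix` ∕ `ThetaTypeAt` δ-unfolded (= ★ `stubGRD_of_pointwise`'s conclusion VERBATIM), so the
  fold elaborates by unfolding the sub-line's own two `def`s.

After this file + the fold, the sub-line's live letters are {S2♭∕S2♯ (engine, P3), GR91N (PRINT), D7α (PRINT), RIG∞″ (arith ★ p818525 + glue)} —
in-house(P2) = ∅.  No `def`, no `sorry`, no measure.

## References
* [GelbartRogawski1991] S. Gelbart, J. Rogawski, Invent. Math. 105 (1991): §5.1 (5.1.1) p. 465, Lemma 5.1.2 pp. 465–466; §1.4 pp. 450–451.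
* [Rogawski1990] J. Rogawski, Ann. of Math. Stud. 123: Lemma 4.13.1 (b) p. 62; §12.2 (2) p. 174; §13.1 p. 199.
* [Kudla1994] S. Kudla, Israel J. Math. 87 (1994): Thm. 3.1 (splittings; locality in the splitting character).
* [Minguez2008] A. Mínguez, Ann. Sci. ÉNS 41 (2008): Thm. 1 (split places, type II).
* [Liu2021] Y. Liu, arXiv:2102.11518: Def. 4.11, App. D §D.1.
-/

set_option autoImplicit false
-- the mandated namespace has the single-problem summit's repeated segment (`HodgeConjecture.HodgeConjecture`)
set_option linter.dupNamespace false

noncomputable section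

open scoped Matrix Kronecker MatrixGroups MonoidAlgebra
open NumberField IsDedekindDomain MeasureTheory
open Literature.NumberTheory Literature.NumberTheory.Automorphic Literature.NumberTheory.Automorphic.UnitaryGroup
open Literature.NumberTheory.Automorphic.IdeleClassGroup
open Literature.NumberTheory.Automorphic.Liu2021 Literature.NumberTheory.Automorphic.Liu2021.Def411WeilCarriers
open Literature.NumberTheory.Automorphic.Liu2021.Def411WeilCarriersDoubling
open Literature.NumberTheory.GelbartRogawski1991 Literature.NumberTheory.GelbartRogawski1991.UnitaryDualPair
open Literature.NumberTheory.GelbartRogawski1991.UnitaryDualPair.WeilCoinv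
open Literature.NumberTheory.GelbartRogawski1991.UnitaryDualPair.LocalSplitting
open Literature.RepresentationTheory Literature.RepresentationTheory.Liu2021 Literature.RepresentationTheory.HarrisKudlaSweet1996
open Literature.NumberTheory.GaloisRepresentations
open Literature.NumberTheory.Rogawski1990
open Summit.HodgeConjecture.CorCM.Transposition
open Summit.HodgeConjecture.HodgeConjecture.Cruxes.H413

namespace Summit.HodgeConjecture.HodgeConjecture.Cruxes.H413.F0P2iGRDAssembly

set_option synthInstance.maxHeartbeats 400000 in
set_option maxHeartbeats 8000000 in
/-- **THE FINITE GELBART–ROGAWSKI DICTIONARY AT THE WITNESS `(μ_ξ, χ_f) = (grdMu, grdChi)`, FROM THE ONE PRINT LETTER U′-N** — the statement of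
record of F0P2-plan (g6) 09:59:07Z: ★ `GRDMatrixCM` (the sub-line's `GRDMatrix` by `Iff.rfl` ∕ δ-unfolding, ★ `grdMatrix_iff_CM_of`) at F0P2-p01 (g5)'s
DICT-CHOICE witness.  (S) split places: ★ `F0P2iGRDSplit.grdMatrix_split_of_dictionary` at the witness, its two split identities being the witness's
(Dν) `splitNu0_eq_localComponent_of_pin` ∕ (Dψ) `locPsi_eq_wReading_mul_zpow_of_pins` from the pins, each place read into `ThetaTypeAtCM` through the ★
bridge `thetaTypeAt_iff_CM` (`.mp`); (N) non-split places: the letter's projection ★ `GR91Lemma512NonsplitAsPrinted.nonsplit` at the pins (Dμ)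
`semilocalComponent_toHeckeCharacter_grdMu` ∕ (Dχ) `grdChi_finAdelicCheck` — already in `ThetaTypeAtCM` currency.  The v1.4 head's `hm`.
[cite: GelbartRogawski1991, §5.1 (5.1.1) p. 465, Lem. 5.1.2 pp. 465–466] [cite: Rogawski1990, Lemma 4.13.1 (b) p. 62; §12.2 (2) p. 174; §13.3 p. 195]
[cite: Minguez2008, Thm. 1] [cite: Liu2021, Def. 4.11; App. D §D.1 (l. 5224)] -/
theorem grdMatrix_grdMu_grdChi_of_GR91N (hGR : GR91Lemma512NonsplitAsPrinted)
    (L : Type) [Field L] [NumberField L] [IsCMField L] (H : Matrix (Fin 3) (Fin 3) L) (hH : (H.map (cmConjRingHom L))ᵀ = H) (hHd : IsUnit H.det)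
    {n' : ℕ} (e₁ : Fin 3 × Fin 1 ≃ Fin n') (dV : Fin 3 → L) (hdV : ∀ i, IsCMField.complexConj L (dV i) = dV i) (hdV0 : ∀ i, dV i ≠ 0) (g : GL (Fin 3) L)
    (hg : ((g : Matrix (Fin 3) (Fin 3) L).map (cmConjRingHom L))ᵀ * H * (g : Matrix (Fin 3) (Fin 3) L) = Matrix.diagonal dV)
    (ξ : OneDimAutRepH L) (μω : HeckeCharacter L) (hμu : μω.IsUnitary)
    (hquad : ∀ x : Literature.NumberTheory.GaloisRepresentations.ideleGroup ↥(maximalRealSubfield L),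
      μω (AdeleRing.ideleBaseChange (↥(maximalRealSubfield L)) L x) = quadraticHeckeCharCM L x) :
    GRDMatrixCM L H hH hHd e₁ dV hdV hdV0 g hg ξ μω hμu (F0P2iGRDWitness.grdMu L ξ μω hμu) (F0P2iGRDWitness.isConjugateSymplectic_grdMu L ξ μω hμu hquad) (F0P2iGRDWitness.grdChi L ξ μω hquad) := by
  refine ⟨fun Pv hPv v hs c hc => ?_, fun v hv T a ha h => ?_⟩
  · -- (S) split places, at the witness: ★ p817998 fed the witness's split identities (Dν), (Dψ); Lines currency → `ThetaTypeAtCM` by the bridge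
    obtain ⟨ε, hΘ⟩ := F0P2iGRDSplit.grdMatrix_split_of_dictionary L H hH hHd e₁ dV hdV hdV0 g hg ξ μω hμu (F0P2iGRDWitness.grdMu L ξ μω hμu)
      (F0P2iGRDWitness.isConjugateSymplectic_grdMu L ξ μω hμu hquad) (F0P2iGRDWitness.grdChi L ξ μω hquad)
      (F0P2iGRDWitness.norm_grdChi_apply L ξ hμu hquad) (F0P2iGRDWitness.continuous_grdChi L ξ μω hquad)
      (fun v w _ => F0P2iGRDWitness.splitNu0_eq_localComponent_of_pin L ξ μω (F0P2iGRDWitness.grdMu L ξ μω hμu) v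
        (F0P2iGRDWitness.semilocalComponent_toHeckeCharacter_grdMu L ξ μω hμu v) w)
      (fun v w _ => F0P2iGRDWitness.locPsi_eq_wReading_mul_zpow_of_pins L ξ μω (F0P2iGRDWitness.grdMu L ξ μω hμu)
        (F0P2iGRDWitness.grdChi L ξ μω hquad) (Def411WeilCarriers.complexConj_mul_complexConj' L)
        (F0P2iGRDWitness.grdChi_finAdelicCheck L ξ μω hquad _) v
        (F0P2iGRDWitness.semilocalComponent_toHeckeCharacter_grdMu L ξ μω hμu v) w) Pv hPv v hs c hc
    exact ⟨ε, (F0P2iVocabularyBridge.thetaTypeAt_iff_CM L H e₁ dV hdV hdV0 g hg (F0P2iGRDWitness.grdMu L ξ μω hμu)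
          (F0P2iGRDWitness.isConjugateSymplectic_grdMu L ξ μω hμu hquad) (F0P2iGRDWitness.grdChi L ξ μω hquad) ε v c).mp hΘ⟩
  · -- (N) non-split places, at the witness: the PRINT letter U′-N at the pins (Dμ), (Dχ)
    exact hGR.nonsplit L H hH hHd e₁ dV hdV hdV0 g hg ξ μω hμu hquad (F0P2iGRDWitness.grdMu L ξ μω hμu)
      (F0P2iGRDWitness.isConjugateSymplectic_grdMu L ξ μω hμu hquad) (F0P2iGRDWitness.grdChi L ξ μω hquad)
      (F0P2iGRDWitness.continuous_grdChi L ξ μω hquad) (F0P2iGRDWitness.norm_grdChi_apply L ξ hμu hquad)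
      (F0P2iGRDWitness.semilocalComponent_toHeckeCharacter_grdMu L ξ μω hμu) (F0P2iGRDWitness.grdChi_finAdelicCheck L ξ μω hquad _) v hv T a ha h

set_option synthInstance.maxHeartbeats 400000 in
set_option maxHeartbeats 8000000 in
/-- **THE GRD CLOSER IN THE REGISTERED ∃-FORM — `StubGRD` (sub-line v1.1 :318–331, body VERBATIM with `GRDMatrix`∕`ThetaTypeAt` δ-unfolded = ★
`stubGRD_of_pointwise`'s conclusion) FROM THE ONE PRINT LETTER U′-N**: by GRD-LOC (★ `F0P2iGRDMatrixLocality.stubGRD_of_pointwise`: the matrix depends on `μ`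
only through its finite semi-local components [Kudla1994, Thm. 3.1]) it suffices to give the witness `(grdMu, grdChi)` (continuous, unitary) with its matrix;
(S) as in `grdMatrix_grdMu_grdChi_of_GR91N` (Lines currency, no bridge needed), (N) = the letter read back into the sub-line's `ThetaTypeAt` currency by
`thetaTypeAt_iff_CM` (`.mpr`).  The registrar's v1.3 fold (if cut): `theorem stub_GRD : StubGRD := stubGRD_of_GR91N stub_GR91N`.
[cite: GelbartRogawski1991, §5.1 (5.1.1) p. 465, Lem. 5.1.2 pp. 465–466] [cite: Kudla1994, Thm. 3.1] [cite: Rogawski1990, §12.2 (2) p. 174] -/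
theorem stubGRD_of_GR91N (hGR : GR91Lemma512NonsplitAsPrinted) :
    ∀ (L : Type) [Field L] [NumberField L] [IsCMField L] (H : Matrix (Fin 3) (Fin 3) L) (hH : (H.map (cmConjRingHom L))ᵀ = H) (hHd : IsUnit H.det)
      {n' : ℕ} (e₁ : Fin 3 × Fin 1 ≃ Fin n') (dV : Fin 3 → L) (hdV : ∀ i, IsCMField.complexConj L (dV i) = dV i) (hdV0 : ∀ i, dV i ≠ 0) (g : GL (Fin 3) L)
      (hg : ((g : Matrix (Fin 3) (Fin 3) L).map (cmConjRingHom L))ᵀ * H * (g : Matrix (Fin 3) (Fin 3) L) = Matrix.diagonal dV)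
      (ξ : OneDimAutRepH L) (μω : HeckeCharacter L) (hμu : μω.IsUnitary),
      (∀ x : Literature.NumberTheory.GaloisRepresentations.ideleGroup ↥(maximalRealSubfield L), μω (AdeleRing.ideleBaseChange (↥(maximalRealSubfield L)) L x) = quadraticHeckeCharCM L x) →
      ∃ (μ₀ : Literature.NumberTheory.Automorphic.IdeleClassGroup L →ₜ* Circle) (_hμ₀ : IsConjugateSymplectic L μ₀)
        (χf : UnitaryGroup.finAdelicOne (↥(maximalRealSubfield L)) L (IsCMField.complexConj L) →* ℂˣ),
        Continuous χf ∧ (∀ z, ‖((χf z : ℂˣ) : ℂ)‖ = 1) ∧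
        ∀ (μ : Literature.NumberTheory.Automorphic.IdeleClassGroup L →ₜ* Circle) (hμ : IsConjugateSymplectic L μ),
          (∀ v : HeightOneSpectrum (𝓞 ↥(maximalRealSubfield L)),
            (toHeckeCharacter L μ).semilocalComponent L v = (toHeckeCharacter L μ₀).semilocalComponent L v) →
          ((∀ Pv : ∀ v : HeightOneSpectrum (𝓞 ↥(maximalRealSubfield L)), CMLocalAPacket L H v,
              ξ.IsXiLocalFamily hH hHd μω hμu Pv →
              ∀ (v : HeightOneSpectrum (𝓞 ↥(maximalRealSubfield L))),
                (∃ w : PlacesOver L v, IsCMField.complexConj L • w.1 ≠ w.1) →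
                ∀ c : IrrClass ((cmDatum L 3 H).Local v), c ∈ (Pv v).members →
                  ∃ ε : (↥(maximalRealSubfield L))ˣ,
                    (∀ (T : Type) [AddCommGroup T] [Module ℂ T] (τ : Representation ℂ ↥(localPi L (IsCMField.complexConj L) 3 H v) T), τ.IsIrreducible →
                      (IrrClass.comap (localPiEquiv L (IsCMField.complexConj L) 3 H v) c).IsConstituentOf τ →
                      ∀ (W' : Type) [AddCommGroup W'] [Module ℂ W'] (ρ' : Representation ℂ ↥(localPi L (IsCMField.complexConj L) 3 H v) W'),
                        isotypicComponent (MonoidAlgebra ℂ (localPi L (IsCMField.complexConj L) 3 H v)) (Representation.asModule ρ')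
                            (Representation.asModule τ) = ⊤ →
                        isotypicComponent (MonoidAlgebra ℂ (localPi L (IsCMField.complexConj L) 3 H v)) (Representation.asModule ρ')
                          (Representation.asModule
                            (((show Representation ℂ (localPi L (IsCMField.complexConj L) 3 (Matrix.diagonal dV) v) _ from
                              (TwistedCoinv.rep (localCharOfCenter (↥(maximalRealSubfield L)) L (IsCMField.complexConj L)
                                  (JW (↥(maximalRealSubfield L)) L ε) (JW_apply_ne_zero (↥(maximalRealSubfield L)) L ε) χf v)
                                ((OmegaChiSplitting.chiLocalSplittingsD ⟨L⟩ e₁ dV hdV hdV0 (toHeckeCharacter L μ)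
                                  ((isOscillatorChar_toHeckeCharacter_iff μ).mpr hμ) ε).omegaLoc v)
                                (commute_omegaLoc_localCenter (↥(maximalRealSubfield L)) L (IsCMField.complexConj L) 3 e₁ (Matrix.diagonal dV)
                                  (JW (↥(maximalRealSubfield L)) L ε) (complexConj_imagUnit L) (imagUnit_ne_zero L) (imagUnit_mul_self L)
                                  (realDiagonal_isSymm L dV hdV) (isSymm_TW (↥(maximalRealSubfield L)) ε) (realDiagonal_map L dV hdV).symm
                                  (JW_eq (↥(maximalRealSubfield L)) L ε) (JW_apply_ne_zero (↥(maximalRealSubfield L)) L ε)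
                                  (OmegaChiSplitting.chiLocalSplittingsD ⟨L⟩ e₁ dV hdV hdV0 (toHeckeCharacter L μ)
                                    ((isOscillatorChar_toHeckeCharacter_iff μ).mpr hμ) ε) v)).comp
                                (UnitaryGroup.localLineInl L (IsCMField.complexConj L) 3 e₁ (Matrix.diagonal dV) (JW (↥(maximalRealSubfield L)) L ε) v)) :
                                localPi L (IsCMField.complexConj L) 3 (Matrix.diagonal dV) v →* _).comp
                              (localCongr L (IsCMField.complexConj L) g one_ne_zero
                                (F0P2cOmegaLocalType.formCongr_frame L H dV g hg) v).symm.toMulEquiv.toMonoidHom)) = ⊤)) ∧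
          (∀ (v : HeightOneSpectrum (𝓞 ↥(maximalRealSubfield L))),
              (∀ w : PlacesOver L v, IsCMField.complexConj L • w.1 = w.1) →
              ∀ (T : GL (Fin 3) (UnitaryGroup.LocalRing L v)) (a : UnitaryGroup.LocalRing L v) (ha : IsUnit a)
                (h : formCongr (conjLocal L (IsCMField.complexConj L) v) T (H.map (algebraMap L (UnitaryGroup.LocalRing L v))) =
                  a • (Matrix.of fun i j : Fin 3 => if i.val + j.val + 1 = 3 then (1 : L) else 0).map (algebraMap L (UnitaryGroup.LocalRing L v))),
                ∃ x₀ : IrrClass (Gqs L v),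
                  x₀.IsConstituentOf (cmPrincipalSeries L 3 v (cmXiTorusChar L v (μω.semilocalComponent L v)
                    (torusLocalComponent L (IsCMField.complexConj L) v ξ.η) (torusLocalComponent L (IsCMField.complexConj L) v ξ.ψ))) ∧
                  ∃ ε : (↥(maximalRealSubfield L))ˣ,
                    (∀ (T' : Type) [AddCommGroup T'] [Module ℂ T'] (τ : Representation ℂ ↥(localPi L (IsCMField.complexConj L) 3 H v) T'), τ.IsIrreducible →
                      (IrrClass.comap (localPiEquiv L (IsCMField.complexConj L) 3 H v) (IrrClass.comap (cmDatumLocalCongr L v T ha h).symm x₀)).IsConstituentOf τ →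
                      ∀ (W' : Type) [AddCommGroup W'] [Module ℂ W'] (ρ' : Representation ℂ ↥(localPi L (IsCMField.complexConj L) 3 H v) W'),
                        isotypicComponent (MonoidAlgebra ℂ (localPi L (IsCMField.complexConj L) 3 H v)) (Representation.asModule ρ')
                            (Representation.asModule τ) = ⊤ →
                        isotypicComponent (MonoidAlgebra ℂ (localPi L (IsCMField.complexConj L) 3 H v)) (Representation.asModule ρ')
                          (Representation.asModule
                            (((show Representation ℂ (localPi L (IsCMField.complexConj L) 3 (Matrix.diagonal dV) v) _ from
                              (TwistedCoinv.rep (localCharOfCenter (↥(maximalRealSubfield L)) L (IsCMField.complexConj L)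
                                  (JW (↥(maximalRealSubfield L)) L ε) (JW_apply_ne_zero (↥(maximalRealSubfield L)) L ε) χf v)
                                ((OmegaChiSplitting.chiLocalSplittingsD ⟨L⟩ e₁ dV hdV hdV0 (toHeckeCharacter L μ)
                                  ((isOscillatorChar_toHeckeCharacter_iff μ).mpr hμ) ε).omegaLoc v)
                                (commute_omegaLoc_localCenter (↥(maximalRealSubfield L)) L (IsCMField.complexConj L) 3 e₁ (Matrix.diagonal dV)
                                  (JW (↥(maximalRealSubfield L)) L ε) (complexConj_imagUnit L) (imagUnit_ne_zero L) (imagUnit_mul_self L)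
                                  (realDiagonal_isSymm L dV hdV) (isSymm_TW (↥(maximalRealSubfield L)) ε) (realDiagonal_map L dV hdV).symm
                                  (JW_eq (↥(maximalRealSubfield L)) L ε) (JW_apply_ne_zero (↥(maximalRealSubfield L)) L ε)
                                  (OmegaChiSplitting.chiLocalSplittingsD ⟨L⟩ e₁ dV hdV hdV0 (toHeckeCharacter L μ)
                                    ((isOscillatorChar_toHeckeCharacter_iff μ).mpr hμ) ε) v)).comp
                                (UnitaryGroup.localLineInl L (IsCMField.complexConj L) 3 e₁ (Matrix.diagonal dV) (JW (↥(maximalRealSubfield L)) L ε) v)) :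
                                localPi L (IsCMField.complexConj L) 3 (Matrix.diagonal dV) v →* _).comp
                              (localCongr L (IsCMField.complexConj L) g one_ne_zero
                                (F0P2cOmegaLocalType.formCongr_frame L H dV g hg) v).symm.toMulEquiv.toMonoidHom)) = ⊤))) := by
  refine F0P2iGRDMatrixLocality.stubGRD_of_pointwise ?_
  intro L _ _ _ H hH hHd n' e₁ dV hdV hdV0 g hg ξ μω hμu hquad
  refine ⟨F0P2iGRDWitness.grdMu L ξ μω hμu, F0P2iGRDWitness.isConjugateSymplectic_grdMu L ξ μω hμu hquad,
    F0P2iGRDWitness.grdChi L ξ μω hquad, F0P2iGRDWitness.continuous_grdChi L ξ μω hquad,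
    F0P2iGRDWitness.norm_grdChi_apply L ξ hμu hquad, ?_, fun v hv T a ha h => ?_⟩
  · -- (S) split places, at the witness (Lines currency, direct)
    exact F0P2iGRDSplit.grdMatrix_split_of_dictionary L H hH hHd e₁ dV hdV hdV0 g hg ξ μω hμu (F0P2iGRDWitness.grdMu L ξ μω hμu)
      (F0P2iGRDWitness.isConjugateSymplectic_grdMu L ξ μω hμu hquad) (F0P2iGRDWitness.grdChi L ξ μω hquad)
      (F0P2iGRDWitness.norm_grdChi_apply L ξ hμu hquad) (F0P2iGRDWitness.continuous_grdChi L ξ μω hquad)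
      (fun v w _ => F0P2iGRDWitness.splitNu0_eq_localComponent_of_pin L ξ μω (F0P2iGRDWitness.grdMu L ξ μω hμu) v
        (F0P2iGRDWitness.semilocalComponent_toHeckeCharacter_grdMu L ξ μω hμu v) w)
      (fun v w _ => F0P2iGRDWitness.locPsi_eq_wReading_mul_zpow_of_pins L ξ μω (F0P2iGRDWitness.grdMu L ξ μω hμu)
        (F0P2iGRDWitness.grdChi L ξ μω hquad) (Def411WeilCarriers.complexConj_mul_complexConj' L)
        (F0P2iGRDWitness.grdChi_finAdelicCheck L ξ μω hquad _) v
        (F0P2iGRDWitness.semilocalComponent_toHeckeCharacter_grdMu L ξ μω hμu v) w)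
  · -- (N) non-split places, at the witness: the letter, read back through the bridge
    obtain ⟨x₀, hx₀, ε, hΘ⟩ := hGR.nonsplit L H hH hHd e₁ dV hdV hdV0 g hg ξ μω hμu hquad (F0P2iGRDWitness.grdMu L ξ μω hμu)
      (F0P2iGRDWitness.isConjugateSymplectic_grdMu L ξ μω hμu hquad) (F0P2iGRDWitness.grdChi L ξ μω hquad)
      (F0P2iGRDWitness.continuous_grdChi L ξ μω hquad) (F0P2iGRDWitness.norm_grdChi_apply L ξ hμu hquad)
      (F0P2iGRDWitness.semilocalComponent_toHeckeCharacter_grdMu L ξ μω hμu) (F0P2iGRDWitness.grdChi_finAdelicCheck L ξ μω hquad _) v hv T a ha h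
    exact ⟨x₀, hx₀, ε, (F0P2iVocabularyBridge.thetaTypeAt_iff_CM L H e₁ dV hdV hdV0 g hg (F0P2iGRDWitness.grdMu L ξ μω hμu)
          (F0P2iGRDWitness.isConjugateSymplectic_grdMu L ξ μω hμu hquad) (F0P2iGRDWitness.grdChi L ξ μω hquad) ε v
      (IrrClass.comap (cmDatumLocalCongr L v T ha h).symm x₀)).mpr hΘ⟩

end Summit.HodgeConjecture.HodgeConjecture.Cruxes.H413.F0P2iGRDAssembly

end
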